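import Summits.QuantumFields.YangMills.Theorems.BalabanUVNodesN08HaarCompatibilityGuardPowerMap
import Summits.QuantumFields.YangMills.Theorems.BalabanUVNodesK0VariationalThm1DatumCoupling

/-!
# BalabanUVNodes ∕ N08 — THE FLAT FIBRE LAW OF THE TYPED (0.4) AVERAGING ∕ OF PART 8's `Ψ` IS NOT HAAR (`SU(N)`, `N ≥ 2`):
# `(g ↦ Ū(c)(1[β(c) ↦ g]))_* Haar ≠ Haar` — the fibrewise form of `Ψ_*(dU) = dU` FAILS at the flat background

WIDTH SEAT `pub-ymgap-dag-n08-w3` g3, plan `W-SEAT-START-LIST.md` v8 §n08 item 3 PART 11B (measure half of part 11 p601453 `…GuardPowerMap`; split by topic at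
the 400-line lint), 2026-08-28.  Track A, DAG node N08 = [Balaban1985UV3] Thm 1 p. 257 (compact) + Thm 2 p. 272; key item K1⁷ `StabilityBAtRecordR13SepCoPH`
(stmt-QuantumFields-20542), `--supports … --as helper`.  COUNT-NEUTRAL.

THE POINT.  Part 11 computed the flat fibre map of the typed averaging: `g ↦ Ū(c)(1[β(c) ↦ g])` is the `L^{1−d}`-power map `exp(λ log g)` on the guard ball
`{‖g − 1‖ < δ_N}` and the identity off it, and it sends the guard ball INTO the closed ball of radius `ρ = e^{2δ_N∕3} − 1 < δ_N`.  Such a map cannot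
preserve Haar measure: the preimage of the closed `ρ`-ball contains the whole guard ball, i.e. the `ρ`-ball AND the annulus `{ρ < dist1 < δ_N}`, and on
`SU(N)`, `N ≥ 2`, that annulus is open and NON-EMPTY — every value in `[0, 2]` is a distance to `1` on `SU(N)` (the tree's
`K0VariationalThm1DatumCoupling.exists_su_dist1_eq`, p5xxxxx of the K0⁗ lane, cited BY NAME) — hence Haar-positive (normalised Haar charges open sets).  So `(flat fibre)_* Haar (ρ-ball) > Haar(ρ-ball)` (`map_haar_flatFibre_apply_gt`) and the flat fibre law is NOT Haar
(`map_haar_flatFibre_ne`); by part 11's `reparam_update_one_apply` the same law is the flat fibre law of part 8's central reparametrisation `Ψ` at `c`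
(`map_haar_reparamFibre_one_ne`): the natural fibrewise strengthening «every fibre map of `Ψ` preserves Haar» of part 8's sufficient condition is FALSE.
Part 12 spreads this strict defect to a `dU`-positive set of backgrounds (tube lemma) and refutes `Ψ_*(dU) = dU` itself.

WHAT THIS FILE PROVES ([folklore] over landed modules; nothing of Bałaban's asserted; 0 `def`).  §1 `isOpenPosMeasure_haar_SU`, ★ `haar_annulus_pos`
(`0 ≤ a < b ≤ 2`, `N ≥ 2`).  §2 (`d ≥ 2`, standing range) `measurable_flatFibre`, `ball_subset_preimage_flatFibre`,
★★ `map_haar_flatFibre_apply_gt`, ★★ `map_haar_flatFibre_ne`, ★ `map_haar_reparamFibre_one_ne`.  §3 at the [B10] slot `avOfPrint N S j`: `map_haar_avOfPrint_flatFibre_ne`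
(every `N ≥ 2`, every member, every in-range level, every coarse bond).

HONEST FRAMING.  A fibre law at ONE (flat, `dU`-null) background: this refutes the FIBREWISE form of road (iv), not yet `Ψ_*(dU) = dU` (part 12) and not
E6′ (which by part 6 is the restricted identity on the guard and stays UNDECIDED); count-neutral; N08 NOT discharged; counts unmoved (typed 28∕28 ·
discharged 5∕27); one finite 𝕋⁴ programme at fixed ε — R4 closes the CONDITIONAL rung `BalabanLadder.UV` only; the Yang–Mills mass gap (Clay) is NOT proved
by any of this; nothing continuum ∕ ℝ³ ∕ ℝ⁴ ∕ OS ∕ mass gap.  0 `sorry`, 0 `def`, 0 `instance`, standard axioms.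
-/

noncomputable section

open MeasureTheory Function NormedSpace

namespace Summit.QuantumFields.YangMills.BalabanUVNodes.N08HaarCompatibilityGuardFlatFibre

open Literature.MathematicalPhysics.QuantumFieldTheory.Balaban1983to89
open Literature.MathematicalPhysics.QuantumFieldTheory.Balaban1983to89.T4Continuum
open Literature.MathematicalPhysics.QuantumFieldTheory.Balaban1983to89.BlockAveraging (Idx Small corr avgFun measurable_avgFun)
open Literature.MathematicalPhysics.QuantumFieldTheory.Balaban1983to89.BlockAveragingHaarAC (centralBond pre)
open Summit.QuantumFields.YangMills.BalabanUVNodes.N08HaarCompatibilityGuardPowerMap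
  (dist1_avgFun_update_one_le rho_lt_deltaSU reparam_update_one_apply)

/-! ## §1. Annuli `{a < dist1 < b}` in `SU(N)`, `N ≥ 2`, are Haar-positive -/

section NotHaar

open scoped Matrix.Norms.L2Operator
open ExpMeanLog (expMeanLogSU deltaSU deltaSU_pos lt_third_of_lt_deltaSU measurable_expMeanLogSU_E)
open Literature.MathematicalPhysics.QuantumFieldTheory.Balaban1983to89.Node00 (SU)
open Summit.QuantumFields.YangMills.Theorems.K0VariationalThm1DatumCoupling (exists_su_dist1_eq)
open Summit.QuantumFields.BalabanUV.T4Continuum.SubstrateBlockAvgContinuity (continuous_dist1_SU)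

variable (N : ℕ) [NeZero N] {P : Params} {j : ℕ}

/-- Normalised Haar measure on `SU(N)` charges every non-empty open set (it is Mathlib's `haarMeasure`; plumbing). [folklore] -/
theorem isOpenPosMeasure_haar_SU : (HaarData.haar : Measure (SU N)).IsOpenPosMeasure := by
  show (Literature.MathematicalPhysics.QuantumFieldTheory.haarProbability (SU N)).IsOpenPosMeasure
  unfold Literature.MathematicalPhysics.QuantumFieldTheory.haarProbability
  infer_instance

/-- **AN ANNULUS `{a < dist1 < b}` IN `SU(N)`, `N ≥ 2`, `0 ≤ a < b ≤ 2`, HAS POSITIVE HAAR MEASURE** (open by continuity of `dist1`, non-empty by the K0⁗ lane's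
`exists_su_dist1_eq`). [folklore] -/
theorem haar_annulus_pos (hN : 2 ≤ N) {a b : ℝ} (ha : 0 ≤ a) (hab : a < b) (hb : b ≤ 2) :
    0 < (HaarData.haar : Measure (SU N)) {g : SU N | a < dist1 g ∧ dist1 g < b} := by
  haveI := isOpenPosMeasure_haar_SU N
  have hopen : IsOpen {g : SU N | a < dist1 g ∧ dist1 g < b} :=
    (isOpen_lt continuous_const (continuous_dist1_SU (n := Fin N))).inter (isOpen_lt (continuous_dist1_SU (n := Fin N)) continuous_const)
  obtain ⟨g, hg⟩ := exists_su_dist1_eq (N := N) hN (t := (a + b) / 2) (by linarith) (by linarith)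
  exact hopen.measure_pos _ ⟨g, by simp only [Set.mem_setOf_eq, hg]; constructor <;> linarith⟩

/-! ## §2. The flat fibre law is NOT Haar -/

/-- The flat fibre map `g ↦ Ū(c)(1[β(c) ↦ g])` is measurable. [folklore] -/
theorem measurable_flatFibre (c : PBond P (j + 1)) :
    Measurable fun g : SU N => avgFun (expMeanLogSU : LoopAverage (SU N)) (update (1 : GaugeField P j (SU N)) (centralBond c) g) c :=
  (measurable_pi_apply c).comp ((measurable_avgFun (expMeanLogSU : LoopAverage (SU N)) measurable_expMeanLogSU_E).comp (measurable_update _))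

/-- **THE FLAT FIBRE MAP SENDS THE GUARD BALL INTO THE `ρ`-BALL AND FIXES ITS COMPLEMENT**, `ρ = exp(2δ_N∕3) − 1 < δ_N`: so the preimage of the closed
`ρ`-ball CONTAINS the whole guard ball `{dist1 < δ_N}`. [cite: Balaban1987RG1, (0.4) p.253 (bookkeeping)] -/
theorem ball_subset_preimage_flatFibre (hj : j + 1 ≤ P.m + P.K) (hd : 2 ≤ P.d) (c : PBond P (j + 1)) :
    {g : SU N | dist1 g < deltaSU (Fin N)} ⊆
      (fun g : SU N => avgFun (expMeanLogSU : LoopAverage (SU N)) (update (1 : GaugeField P j (SU N)) (centralBond c) g) c) ⁻¹'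
        {h : SU N | dist1 h ≤ Real.exp (2 * deltaSU (Fin N) / 3) - 1} :=
  fun g hg => dist1_avgFun_update_one_le N hj hd c g hg

/-- **THE FLAT FIBRE LAW IS NOT HAAR** (`SU(N)`, `N ≥ 2`, `d ≥ 2`, standing range): the law of `g ↦ Ū(c)(1[β(c) ↦ g])` under Haar gives the closed
`ρ`-ball at least the mass of the guard ball `{dist1 < δ_N}`, which exceeds the Haar mass of the `ρ`-ball by the (positive) mass of the annulus
`{ρ < dist1 < δ_N}`. [cite: Balaban1987RG1, (0.4) p.253 (the typed averaging; E6′ ∕ fibre-invariance NOT IN PRINT; bookkeeping)] -/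
theorem map_haar_flatFibre_apply_gt (hN : 2 ≤ N) (hj : j + 1 ≤ P.m + P.K) (hd : 2 ≤ P.d) (c : PBond P (j + 1)) :
    (HaarData.haar : Measure (SU N)) {h : SU N | dist1 h ≤ Real.exp (2 * deltaSU (Fin N) / 3) - 1} <
      ((HaarData.haar : Measure (SU N)).map fun g : SU N =>
          avgFun (expMeanLogSU : LoopAverage (SU N)) (update (1 : GaugeField P j (SU N)) (centralBond c) g) c)
        {h : SU N | dist1 h ≤ Real.exp (2 * deltaSU (Fin N) / 3) - 1} := by
  haveI := HaarData.isProb (G := SU N)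
  set ρ : ℝ := Real.exp (2 * deltaSU (Fin N) / 3) - 1 with hρ
  have hmeas : Measurable (dist1 : SU N → ℝ) := RegularGaugeGroup.measurable_dist1
  have hK : MeasurableSet {h : SU N | dist1 h ≤ ρ} := measurableSet_le hmeas measurable_const
  have hρδ : ρ < deltaSU (Fin N) := rho_lt_deltaSU N
  have hρ0 : 0 ≤ ρ := by
    rw [hρ, sub_nonneg]
    exact Real.one_le_exp (by have := deltaSU_pos (n := Fin N); positivity)
  have hδ2 : deltaSU (Fin N) ≤ 2 := (min_le_left _ _).trans (by norm_num)
  rw [Measure.map_apply (measurable_flatFibre N c) hK]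
  -- the preimage contains the disjoint union `{dist1 ≤ ρ} ∪ {ρ < dist1 < δ}` = `{dist1 < δ}`
  have hsplit : {h : SU N | dist1 h ≤ ρ} ∪ {g : SU N | ρ < dist1 g ∧ dist1 g < deltaSU (Fin N)} ⊆
      (fun g : SU N => avgFun (expMeanLogSU : LoopAverage (SU N)) (update (1 : GaugeField P j (SU N)) (centralBond c) g) c) ⁻¹'
        {h : SU N | dist1 h ≤ ρ} := by
    rintro g (hg | hg)
    · exact ball_subset_preimage_flatFibre N hj hd c (lt_of_le_of_lt hg hρδ)
    · exact ball_subset_preimage_flatFibre N hj hd c hg.2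
  have hdisj : Disjoint {h : SU N | dist1 h ≤ ρ} {g : SU N | ρ < dist1 g ∧ dist1 g < deltaSU (Fin N)} :=
    Set.disjoint_left.2 fun g hg hg' => (not_lt.2 hg) hg'.1
  have hann : MeasurableSet {g : SU N | ρ < dist1 g ∧ dist1 g < deltaSU (Fin N)} :=
    (measurableSet_lt measurable_const hmeas).inter (measurableSet_lt hmeas measurable_const)
  calc (HaarData.haar : Measure (SU N)) {h : SU N | dist1 h ≤ ρ}
      < (HaarData.haar : Measure (SU N)) {h : SU N | dist1 h ≤ ρ} +
          (HaarData.haar : Measure (SU N)) {g : SU N | ρ < dist1 g ∧ dist1 g < deltaSU (Fin N)} :=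
        ENNReal.lt_add_right (measure_ne_top _ _) (haar_annulus_pos N hN hρ0 hρδ hδ2).ne'
    _ = (HaarData.haar : Measure (SU N)) ({h : SU N | dist1 h ≤ ρ} ∪ {g : SU N | ρ < dist1 g ∧ dist1 g < deltaSU (Fin N)}) :=
        (measure_union hdisj hann).symm
    _ ≤ _ := measure_mono hsplit

/-- **THE FLAT FIBRE LAW IS NOT HAAR**: `(g ↦ Ū(c)(1[β(c) ↦ g]))_* Haar ≠ Haar` on `SU(N)`, `N ≥ 2` (`d ≥ 2`, standing range).
[cite: Balaban1987RG1, (0.4) p.253 (the typed averaging; fibre-invariance ∕ E6′ NOT IN PRINT — here REFUTED at the flat background; bookkeeping)] -/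
theorem map_haar_flatFibre_ne (hN : 2 ≤ N) (hj : j + 1 ≤ P.m + P.K) (hd : 2 ≤ P.d) (c : PBond P (j + 1)) :
    ((HaarData.haar : Measure (SU N)).map fun g : SU N =>
        avgFun (expMeanLogSU : LoopAverage (SU N)) (update (1 : GaugeField P j (SU N)) (centralBond c) g) c) ≠ HaarData.haar := fun h =>
  (map_haar_flatFibre_apply_gt N hN hj hd c).ne' (by rw [h])

/-- **… EQUIVALENTLY FOR PART 8's `Ψ`**: the flat fibre law of the central reparametrisation at `c`, `(g ↦ (Ψ 1[β(c) ↦ g])(β(c)))_* Haar ≠ Haar` — the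
fibrewise form of `Ψ_*(dU) = dU` FAILS at the flat background. [cite: Balaban1987RG1, (0.4) p.253 (bookkeeping; `Ψ_*(dU) = dU` itself is part 12's)] -/
theorem map_haar_reparamFibre_one_ne (hN : 2 ≤ N) (hj : j + 1 ≤ P.m + P.K) (hd : 2 ≤ P.d) (c : PBond P (j + 1)) :
    ((HaarData.haar : Measure (SU N)).map fun g : SU N =>
        (fun b => Function.extend centralBond
          (fun c' => (pre (update (1 : GaugeField P j (SU N)) (centralBond c) g) c')⁻¹ *
            corr (expMeanLogSU : LoopAverage (SU N)) (update (1 : GaugeField P j (SU N)) (centralBond c) g) c' *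
              pre (update (1 : GaugeField P j (SU N)) (centralBond c) g) c') (fun _ => (1 : SU N)) b *
            update (1 : GaugeField P j (SU N)) (centralBond c) g b) (centralBond c)) ≠ HaarData.haar := by
  rw [show (fun g : SU N => (fun b => Function.extend centralBond
          (fun c' => (pre (update (1 : GaugeField P j (SU N)) (centralBond c) g) c')⁻¹ *
            corr (expMeanLogSU : LoopAverage (SU N)) (update (1 : GaugeField P j (SU N)) (centralBond c) g) c' *
              pre (update (1 : GaugeField P j (SU N)) (centralBond c) g) c') (fun _ => (1 : SU N)) b *
            update (1 : GaugeField P j (SU N)) (centralBond c) g b) (centralBond c)) =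
      fun g : SU N => avgFun (expMeanLogSU : LoopAverage (SU N)) (update (1 : GaugeField P j (SU N)) (centralBond c) g) c from
    funext fun g => reparam_update_one_apply _ hj c g]
  exact map_haar_flatFibre_ne N hN hj hd c

end NotHaar

/-! ## §3. At the [B10] slot's averaging `avOfPrint N S j` -/

section Slot

open Literature.MathematicalPhysics.QuantumFieldTheory.Balaban1985CMP102.Setting (Scales)
open Literature.MathematicalPhysics.QuantumFieldTheory.Balaban1983to89.B10RunsOfRecord (avOfPrint)
open ExpMeanLog (expMeanLogSU)
open Literature.MathematicalPhysics.QuantumFieldTheory.Balaban1983to89.Node00 (SU)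
open Summit.QuantumFields.YangMills.BalabanUVNodes.N08HaarCompatibilityGuard (avOfPrint_avg_of_le)

variable (N : ℕ) [NeZero N] {L : ℕ}

/-- **AT THE SLOT: THE FLAT FIBRE LAW OF PRINT's AVERAGING IS NOT HAAR** (`N ≥ 2`, every member, every in-range level, every coarse bond).
[cite: Balaban1985UV3, (2) p.256; Balaban1987RG1, (0.4) p.253 (E6′ ∕ fibre-invariance NOT IN PRINT; bookkeeping)] -/
theorem map_haar_avOfPrint_flatFibre_ne (hN : 2 ≤ N) (S : Scales L) {j : ℕ} (hj : j + 1 ≤ S.P.m + S.P.K)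
    (c : PBond S.P (j + 1)) :
    ((HaarData.haar : Measure (SU N)).map fun g : SU N => (avOfPrint N S j).avg (update (1 : GaugeField S.P j (SU N)) (centralBond c) g) c) ≠
      HaarData.haar := by
  rw [avOfPrint_avg_of_le N S hj]
  exact map_haar_flatFibre_ne N hN hj (show 2 ≤ S.P.d from by show 2 ≤ 3; norm_num) c

end Slot

end Summit.QuantumFields.YangMills.BalabanUVNodes.N08HaarCompatibilityGuardFlatFibre

end
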